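import Literature.Probability.RandomPlanarGeometry.BDGS2012
import HarnessLib

/-!
# The Pönitz–Tittmann upper bound for the connective constant of `ℤ³`: `μ(3) ≤ 4.7387` (named fact)

Topic `Literature/Probability/RandomPlanarGeometry` (next to `BDGS2012.lean`, whose `SAW.Zd.connectiveConstant d = μ(d)`
is the constant bounded, and to `SAWFiniteMemory.lean`, the kernel-checked planar analogue `μ(ℤ²) ≤ N/D`).

A. Pönitz, P. Tittmann, *Improved upper bounds for self-avoiding walks in `ℤ^d`*, Electron. J. Combin. 7 (2000)
R21: "In this paper, we improve these bounds to 2.6792 and 4.7387, respectively" (§1, p. 2; two and three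
dimensions), obtained as the growth rate `μ(3,14)` of the walks on `ℤ³` with no loop of length `≤ 14`, computed from
an automatically generated finite automaton (§2–§3; Table 2, column `d = 3`: `4.8646, 4.8075, 4.7780, 4.7599,
4.7476, 4.7387` for memory `k = 4, 6, …, 14`, "The values shown are true upper bounds").

This file records the three-dimensional bound AS PRINTED as a NAMED FACT (a `def … : Prop`, not proved here: the
source's proof is a certified machine computation with a `k = 14` automaton; the tree's kernel-checked bound of the
same family is the memory-4 value `μ(3) ≤ 4.865` of `IsingCriticalBetaCubic.lean` / `card_memFourWords_three_le`).
Consumers take `(h : PT2000_connectiveConstant_three_le)` as a hypothesis (conditional results), e.g. Fisher's bound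
`tanh β_c(3) ≥ 1/μ(3)` (`lt_criticalBeta_of_le_of_mul_tanh_lt_one`) then gives `β_c(3) > artanh(1/4.7387) = 0.21423…`.

Reference: [PonitzTittmann2000] §1 p. 2, Table 2.
-/

noncomputable section

namespace Literature.Probability.RandomPlanarGeometry.SAW.Zd

/-- **Pönitz–Tittmann 2000 (named fact, as printed): `μ(3) ≤ 4.7387`** — the connective constant of the
self-avoiding walk on `ℤ³` is at most `4.7387` (finite-memory automaton, memory `k = 14`; "The values shown are
true upper bounds"). Unproved in the tree (certified computation in the source); the tree's kernel-checked value of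
the same method at memory `4` is `4.865`. [cite: PonitzTittmann2000, §1 p. 2 and Table 2 (d = 3, k = 14)] -/
def PT2000_connectiveConstant_three_le : Prop :=
  connectiveConstant 3 ≤ 4.7387

end Literature.Probability.RandomPlanarGeometry.SAW.Zd

end
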